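import Literature.Geometry.Kaehler.ComplexTorusIntegralHodgeLatticeLefschetzPieces
import HarnessLib

/-!
# The `s`-fold Lefschetz similarity `B_{m+2s}(θˢ ∧ x, θˢ ∧ y) = C · B_m(x, y)` and the discriminants of the Lefschetz pieces in closed form:
# `disc_B(Lˢ Hdgⁱ(X, ℤ)_prim) = C^{ρ_pr^{(i)}} · disc_{B'}(Hdgⁱ(X, ℤ)_prim)`, `q!·d₁⋯d_q · C = (q+2s)!·d₁⋯d_{q+2s}`

Layer `Literature/Geometry/Kaehler`, namespace `Literature.Geometry.Kaehler.ComplexTorus`; lane `lit-hodgefound`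
(Track 2 foundations library), seat p09, generation 48, row g48-#2. THEOREMS ONLY (0 definitions); no named fact, net debt 0.
For a polarised abelian variety `X` of dimension `g = j + 2` and type `(d₁, …, d_g)` the tree has the ONE-STEP Lefschetz similarity
`⟨x ∧ θ, γ_q ∧ (y ∧ θ)⟩ = (q+1)(q+2)·d_{q+1}d_{q+2} · ⟨x, γ_{q+2} ∧ y⟩` (`ComplexTorusLefschetzFormPrimitiveLatticeEvenDegreeSignature`,
`IsPolarizationType.poincarePairing_wedge_ofRealForm_wedge_wedge_ofRealForm_of_eq_content_smul`; g47-#1/#8 read it on lattices: `disc(θ ∧ N) = c^{rk N}·disc N`).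
Here it is ITERATED along the bundled Lefschetz powers `Lˢ = lefschetzPow η s` (the maps in which the Lefschetz pieces `N_s = Lˢ Hdg^{p−s}(X, ℤ)_prim` of
g47-#3 are written), with the "content" `N_q = q!·d₁⋯d_q` of the type (`θ^{∧q} = N_q · γ_q`, `γ_q ∈ H^{2q}(X, ℤ)` the integral minimal class):

* §0 (private) plumbing: `N_{q+2} = N_q · (q+1)(q+2)d_{q+1}d_{q+2}`, `L^{s+1} x = (Lˢ x) ∧ θ`, re-indexing of `Lˢ`.
* §1 **THE `s`-FOLD SIMILARITY `N_q · ⟨Lˢ x, γ_q ∧ Lˢ y⟩ = N_{q+2s} · ⟨x, γ_{q+2s} ∧ y⟩`** for all complex `m`-forms `x, y` (`2s + m = k`, `k + q = g`;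
  `IsPolarizationType.content_mul_poincarePairing_lefschetzPow_eq`): `B_k(Lˢ x, Lˢ y) = (N_{q+2s}/N_q) · B_m(x, y)` — Voisin's "on `Lʳ H^{k−2r}_prim`, `H_k`
  induces `(−1)ʳ H_{k−2r}`" with the integral normalisation of the Lefschetz forms `B_k = ⟨·, γ_{g−k} ∧ ·⟩` made explicit; induction over the one-step
  similarity, the intermediate minimal classes `γ_{q+2}, γ_{q+4}, …` being supplied by the tree (`exists_mem_integralForms_wedgePow_eq_content_smul`).
  **The ratio `C = N_{q+2s}/N_q = (q+2s)!/q! · d_{q+1}⋯d_{q+2s}` is a positive integer** (`IsPolarizationType.exists_pos_content_mul_eq_content`).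
* §2 ON SUBLATTICES: for `N ⊆ Hᵐ(X, ℤ)` and `N' = Lˢ N ⊆ Hᵏ(X, ℤ)` (membership hypothesis), **`Lˢ` carries every `ℤ`-basis `b` of `N` to a basis `b'` of
  `N'`** (`m + s ≤ g`: hard Lefschetz injectivity; `IsPolarizationType.exists_basis_coe_eq_lefschetzPow`), and in such bases
  **`G_{b'}(B_k∣N') = C · G_b(B_m∣N)`, `disc_{B_k}(N') = C^{rk N} · disc_{B_m}(N)`** (`IsPolarizationType.toMatrix_restrict_eq_smul_of_coe_eq_lefschetzPow`,
  `….det_restrict_eq_pow_mul_det_of_coe_eq_lefschetzPow`).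
* §3 THE LEFSCHETZ PIECES IN CLOSED FORM: the `s`-th piece `N_s` of `Hdgᵖ(X, ℤ)` (`k = p + p`, membership predicate of g47-#3) IS `Lˢ` of the primitive
  Hodge lattice `Hdgⁱ(X, ℤ)_prim = Hdgⁱ(X, ℤ) ∩ Pᵐ` (`i = p − s`, `m = i + i`; `mem_lefschetzPiece_iff_exists_mem_primitiveHodgeLattice`), so
  **`disc_{B_k}(Lˢ Hdgⁱ(X, ℤ)_prim) = C^{ρ_pr^{(i)}} · disc_{B_m}(Hdgⁱ(X, ℤ)_prim)`** with `N_q · C = N_{q+2s}`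
  (`IsPolarizationType.exists_basis_det_restrict_lefschetzPiece_eq_pow_mul_det_primitiveHodgeLattice`): together with g47-#5
  (`∏_s disc N_s = I_p² · disc Hdgᵖ(X, ℤ)`) and g47-#7 (`I_p = ∏_{q'<p} J_{q'+1}`) every discriminant of the integral Lefschetz decomposition is expressed
  through the primitive Hodge lattices `Hdgⁱ(X, ℤ)_prim`, `i ≤ p`, the type `(d₁, …, d_g)` and the one-step indices `J`.

## References

* [cite: VoisinHodgeI2002, §6.3.2 Lemma 6.31, Thm. 6.32 (PDF p. 128); §6.2.3 Lemma 6.26, Rem. 6.27 (PDF p. 126); §7.1.2 (PDF p. 134)]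
* [cite: Lange2023AbelianVarietiesComplex, §5.4.1 Thm. 5.4.2 and (5.22)–(5.23) (PDF p. 275); §7.3.2 (1), (3); §1.5.1 (PDF p. 51); §2.5.3 Thm. 2.5.16, Cor. 2.5.17 (PDF p. 135); §6.2.4 (PDF p. 310)]
* [cite: Huybrechts2016K3, Ch. 14 §0.1 (0.1), §0.2]
* [cite: Kitaoka1993, Ch. 5 §5.3 Prop. 5.3.3 (proof)]
* [cite: Warner1983, 2.6]
-/

noncomputable section

-- `Module ℂ` / `SMulZeroClass ℂ` synthesis on `E [⋀^Fin k]→L[ℝ] ℂ` (as in `ComplexTorusLefschetzDecomposition`)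
set_option maxSynthPendingDepth 3

open Module Function Complex
open LinearMap (BilinForm)
open Literature.LinearAlgebra.Alternating
open Literature.Analysis.Complex (IsOfTypeAt typeSubmodule)

namespace Literature.Geometry.Kaehler.ComplexTorus

/-! ## §0 Plumbing -/

section Plumbing

variable {E : Type*} [NormedAddCommGroup E] [NormedSpace ℂ E] {j q : ℕ}

/-- `(q+2)!·d₁⋯d_{q+2} = (q!·d₁⋯d_q) · ((q+1)(q+2)·d_{q+1}d_{q+2})`. [folklore] -/
private theorem content_succ_succ_eq₉₂ (d : Fin (j + 2) → ℕ) (hq : q ≤ j + 2) (hq2 : q + 1 + 1 ≤ j + 2) :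
    (q + 1 + 1).factorial * ∏ i : Fin (q + 1 + 1), d (Fin.castLE hq2 i) =
      (q.factorial * ∏ i : Fin q, d (Fin.castLE hq i)) *
        ((q + 1) * (q + 2) * d (Fin.castLE hq2 (Fin.last q).castSucc) * d (Fin.castLE hq2 (Fin.last (q + 1)))) := by
  have h1 : ∀ i : Fin q, Fin.castLE hq2 i.castSucc.castSucc = Fin.castLE hq i := fun i ↦ Fin.ext rfl
  rw [Fin.prod_univ_castSucc, Fin.prod_univ_castSucc, Nat.factorial_succ, Nat.factorial_succ]
  simp_rw [h1]
  ring

/-- Re-indexing the exponent of the bundled Lefschetz power along a (propositional) equality of exponents. [folklore] -/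
private theorem lefschetzPow_congr₉₂ (η : E [⋀^Fin 2]→L[ℝ] ℝ) {r₁ r₂ m k : ℕ} (hr : r₁ = r₂) (h₁ : 2 * r₁ + m = k) (h₂ : 2 * r₂ + m = k)
    (y : E [⋀^Fin m]→L[ℝ] ℂ) : lefschetzPow η r₁ h₁ y = lefschetzPow η r₂ h₂ y := by
  subst hr
  rfl

/-- `L^{s+1} x = (Lˢ x) ∧ θ`. [folklore] -/
private theorem lefschetzPow_succ_eq_wedge₉₂ (η : E [⋀^Fin 2]→L[ℝ] ℝ) {s m k₀ : ℕ} (h : 2 * (s + 1) + m = k₀ + 2) (h0 : 2 * s + m = k₀)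
    (x : E [⋀^Fin m]→L[ℝ] ℂ) :
    lefschetzPow η (s + 1) h x = (lefschetzPow η s h0 x).wedge (ofRealForm η : E [⋀^Fin 2]→L[ℝ] ℂ) := by
  have h1 : 2 * 1 + k₀ = k₀ + 2 := by ring
  rw [← lefschetzPow_one_eq_wedge_ofRealForm η h1 (lefschetzPow η s h0 x), lefschetzPow_lefschetzPow]
  exact lefschetzPow_congr₉₂ η (by omega) _ _ x

end Plumbing

/-! ## §1 The `s`-fold Lefschetz similarity -/

section Similarity

variable {ι : Type*} [Fintype ι] [DecidableEq ι] {E : Type*} [NormedAddCommGroup E] [NormedSpace ℂ E]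
  {Φ : (ι → ℝ) ≃L[ℝ] E} {j n m q₂ : ℕ} {η : E [⋀^Fin 2]→L[ℝ] ℝ} {d : Fin (j + 2) → ℕ}

/-- **THE `s`-FOLD LEFSCHETZ SIMILARITY: `N_q · ⟨Lˢ x, γ_q ∧ Lˢ y⟩ = N_{q₂} · ⟨x, γ_{q₂} ∧ y⟩`, `q₂ = q + 2s`**, for all complex `m`-forms `x, y`
(`2s + m = k`, `k + q = g`; `N_q = q!·d₁⋯d_q`, `θ^{∧q} = N_q·γ_q`, `θ^{∧q₂} = N_{q₂}·γ_{q₂}`) — i.e. **`B_k(Lˢ x, Lˢ y) = (N_{q+2s}/N_q) · B_m(x, y)`** for the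
Lefschetz forms `B_k = ⟨·, γ_{g−k} ∧ ·⟩`: the bundled Lefschetz power `Lˢ : Hᵐ → Hᵏ` is a SIMILARITY of the Lefschetz forms with ratio
`(q+2s)!/q! · d_{q+1}⋯d_{q+2s}` (Voisin: "on each primitive component `Lʳ H^{k−2r}(X, ℂ)_prim`, `H_k` induces the form `(−1)ʳ H_{k−2r}`", the sign
being absorbed here in the orientation conventions of `⟨,⟩_e`). Induction on `s` over the one-step similarity (`s ↦ s + 1` passes through `γ_{q+2}`).
[cite: VoisinHodgeI2002, §6.3.2 Lemma 6.31 (PDF p. 128)] [cite: Lange2023AbelianVarietiesComplex, §5.4.1 (5.22) (PDF p. 275); §2.5.3 Thm. 2.5.16, Cor. 2.5.17 (PDF p. 135); §6.2.4 (PDF p. 310)] [cite: Warner1983, 2.6] -/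
theorem IsPolarizationType.content_mul_poincarePairing_lefschetzPow_eq (hd : IsPolarizationType Φ η d) (hη : IsRiemannForm Φ η)
    (e : Fin n ≃ ι) (hq₂' : q₂ ≤ j + 2) {γ₂ : E [⋀^Fin (2 * q₂)]→L[ℝ] ℂ}
    (hγ₂ : wedgePow (ofRealForm η) q₂ = ((q₂.factorial * ∏ i : Fin q₂, d (Fin.castLE hq₂' i) : ℕ) : ℂ) • γ₂)
    (hn₂ : m + (2 * q₂ + m) = n) (x y : E [⋀^Fin m]→L[ℝ] ℂ)
    (s : ℕ) {k q : ℕ} (h : 2 * s + m = k) (hkq : k + q = j + 2) (hq₂ : q + 2 * s = q₂) (hq : q ≤ j + 2)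
    {γ : E [⋀^Fin (2 * q)]→L[ℝ] ℂ} (hγ : wedgePow (ofRealForm η) q = ((q.factorial * ∏ i : Fin q, d (Fin.castLE hq i) : ℕ) : ℂ) • γ)
    (hn : k + (2 * q + k) = n) :
    ((q.factorial * ∏ i : Fin q, d (Fin.castLE hq i) : ℕ) : ℂ) *
        poincarePairing Φ e hn (lefschetzPow η s h x) (γ.wedge (lefschetzPow η s h y)) =
      ((q₂.factorial * ∏ i : Fin q₂, d (Fin.castLE hq₂' i) : ℕ) : ℂ) * poincarePairing Φ e hn₂ x (γ₂.wedge y) := by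
  induction s generalizing k q γ with
  | zero =>
    obtain rfl : m = k := by omega
    obtain rfl : q₂ = q := by omega
    have hc : ((q₂.factorial * ∏ i : Fin q₂, d (Fin.castLE hq₂' i) : ℕ) : ℂ) ≠ 0 := by
      exact_mod_cast (Nat.mul_pos (Nat.factorial_pos q₂) (Finset.prod_pos fun i _ ↦ hd.pos hη _)).ne'
    have hγγ : γ = γ₂ := smul_right_injective (E [⋀^Fin (2 * q₂)]→L[ℝ] ℂ) hc (hγ.symm.trans hγ₂)
    rw [lefschetzPow_zero_apply, lefschetzPow_zero_apply, hγγ]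
  | succ s ih =>
    obtain ⟨k₀, rfl⟩ : ∃ k₀, k = k₀ + 2 := ⟨2 * s + m, by omega⟩
    have h0 : 2 * s + m = k₀ := by omega
    have hq2 : q + 1 + 1 ≤ j + 2 := by omega
    obtain ⟨γ₁, -, hγ₁⟩ := hd.exists_mem_integralForms_wedgePow_eq_content_smul (q := q + 1 + 1) hq2
    have hn₁ : k₀ + (2 * (q + 1 + 1) + k₀) = n := by omega
    rw [lefschetzPow_succ_eq_wedge₉₂ η h h0 x, lefschetzPow_succ_eq_wedge₉₂ η h h0 y,
      hd.poincarePairing_wedge_ofRealForm_wedge_wedge_ofRealForm_of_eq_content_smul hη hq hγ hq2 hγ₁ e hn hn₁, ← mul_assoc,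
      ← Nat.cast_mul, ← content_succ_succ_eq₉₂ d hq hq2]
    exact ih h0 (by omega) (by omega) hq2 hγ₁ hn₁

/-- **The similarity ratio `C = N_{q+2s}/N_q = (q+2s)!/q! · d_{q+1}⋯d_{q+2s}` is a positive integer**: `∃ C > 0`, `N_q · C = N_{q₂}` (`q₂ = q + 2s`).
[cite: Lange2023AbelianVarietiesComplex, §1.5.1 (PDF p. 51); §2.5.3 Thm. 2.5.16 (PDF p. 135)] -/
theorem IsPolarizationType.exists_pos_content_mul_eq_content (hd : IsPolarizationType Φ η d) (hη : IsRiemannForm Φ η)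
    (s : ℕ) {q : ℕ} (hq₂ : q + 2 * s = q₂) (hq : q ≤ j + 2) (hq₂' : q₂ ≤ j + 2) :
    ∃ C : ℕ, 0 < C ∧ (q.factorial * ∏ i : Fin q, d (Fin.castLE hq i)) * C = q₂.factorial * ∏ i : Fin q₂, d (Fin.castLE hq₂' i) := by
  induction s generalizing q₂ with
  | zero =>
    obtain rfl : q = q₂ := by omega
    exact ⟨1, Nat.one_pos, mul_one _⟩
  | succ s ih =>
    obtain ⟨q₁, rfl⟩ : ∃ q₁, q₂ = q₁ + 1 + 1 := ⟨q + 2 * s, by omega⟩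
    have hq₁ : q₁ ≤ j + 2 := by omega
    obtain ⟨C₁, hC₁, hC₁'⟩ := ih (by omega) hq₁
    refine ⟨C₁ * ((q₁ + 1) * (q₁ + 2) * d (Fin.castLE hq₂' (Fin.last q₁).castSucc) * d (Fin.castLE hq₂' (Fin.last (q₁ + 1)))),
      Nat.mul_pos hC₁ (Nat.mul_pos (Nat.mul_pos (Nat.mul_pos (by omega) (by omega)) (hd.pos hη _)) (hd.pos hη _)), ?_⟩
    rw [← mul_assoc, hC₁', content_succ_succ_eq₉₂ d hq₁ hq₂']

end Similarity

/-! ## §2 On sublattices: `Lˢ` carries bases to bases, `G_{Lˢb}(B_k) = C · G_b(B_m)`, `disc_{B_k}(Lˢ N) = C^{rk N} · disc_{B_m}(N)` -/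

section Lattices

variable {ι : Type*} [Fintype ι] [DecidableEq ι] {E : Type*} [NormedAddCommGroup E] [NormedSpace ℂ E]
  {Φ : (ι → ℝ) ≃L[ℝ] E} {j n m k q q₂ s : ℕ} {η : E [⋀^Fin 2]→L[ℝ] ℝ} {d : Fin (j + 2) → ℕ}

omit [DecidableEq ι] in
/-- **`Lˢ` carries a `ℤ`-basis of `N ⊆ Hᵐ(X, ℤ)` to a `ℤ`-basis of `Lˢ N ⊆ Hᵏ(X, ℤ)`** (`2s + m = k`, `m + s ≤ g`): if `N'` is exactly the set of `Lˢ v`,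
`v ∈ N` (membership hypothesis `hN'`), then `Lˢ : N → N'` is a `ℤ`-linear ISOMORPHISM — onto by `hN'`, injective by hard Lefschetz (`Lˢ : Hᵐ → Hᵏ` is
injective for `m + s ≤ g`, the tree's `lefschetzPow_injective`) — so every basis `b` of `N` yields a basis `b'` of `N'` with `b' t = Lˢ (b t)`.
[cite: Lange2023AbelianVarietiesComplex, §7.3.2 (1), (3); §5.4.1 Thm. 5.4.2 (PDF p. 275)] [cite: VoisinHodgeI2002, §6.2.3 Lemma 6.26, Rem. 6.27 (PDF p. 126)] -/
theorem IsPolarizationType.exists_basis_coe_eq_lefschetzPow (hd : IsPolarizationType Φ η d) (hη : IsRiemannForm Φ η)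
    (h : 2 * s + m = k) (hms : m + s ≤ j + 2) {N : Submodule ℤ ↥(integralForms Φ m)} {N' : Submodule ℤ ↥(integralForms Φ k)}
    (hN' : ∀ u : ↥(integralForms Φ k), u ∈ N' ↔ ∃ v ∈ N, (u : E [⋀^Fin k]→L[ℝ] ℂ) = lefschetzPow η s h (v : E [⋀^Fin m]→L[ℝ] ℂ))
    {κ : Type*} (b : Basis κ ℤ ↥N) :
    ∃ b' : Basis κ ℤ ↥N', ∀ t, (((b' t : ↥N') : ↥(integralForms Φ k)) : E [⋀^Fin k]→L[ℝ] ℂ) =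
      lefschetzPow η s h (((b t : ↥N) : ↥(integralForms Φ m)) : E [⋀^Fin m]→L[ℝ] ℂ) := by
  haveI : FiniteDimensional ℝ E := Module.Finite.equiv Φ.toLinearEquiv
  haveI : FiniteDimensional ℂ E := Module.Finite.of_restrictScalars_finite ℝ ℂ E
  have hE : finrank ℝ E = Fintype.card ι := by
    rw [← Φ.toLinearEquiv.finrank_eq, Module.finrank_fintype_fun_eq_card]
  have hg : finrank ℂ E = j + 2 := by
    have h := finrank_real_of_complex E
    rw [hE, hd.card_eq] at h
    omega
  have hnd : ∀ v : E, v ≠ 0 → ∃ w : E, η ![v, w] ≠ 0 := fun v hv ↦ by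
    by_contra h
    push Not at h
    exact hv (hη.nondegenerate v h)
  -- `Lˢ` as a `ℤ`-linear map `N → N'`
  let W : ↥N →ₗ[ℤ] ↥N' :=
    (AddMonoidHom.mk' (fun x : ↥N ↦ (⟨⟨lefschetzPow η s h (((x : ↥N) : ↥(integralForms Φ m)) : E [⋀^Fin m]→L[ℝ] ℂ),
        lefschetzPow_mem_integralForms hη h ((x : ↥N) : ↥(integralForms Φ m)).2⟩, (hN' _).2 ⟨(x : ↥(integralForms Φ m)), x.2, rfl⟩⟩ : ↥N'))
      (fun x y ↦ Subtype.ext (Subtype.ext (map_add (lefschetzPow η s h) _ _)))).toIntLinearMap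
  have hW : ∀ x : ↥N, (((W x : ↥N') : ↥(integralForms Φ k)) : E [⋀^Fin k]→L[ℝ] ℂ) =
      lefschetzPow η s h (((x : ↥N) : ↥(integralForms Φ m)) : E [⋀^Fin m]→L[ℝ] ℂ) := fun _ ↦ rfl
  have hinj : Injective W := fun x y hxy ↦ by
    have h' := congrArg (fun u : ↥N' ↦ ((u : ↥(integralForms Φ k)) : E [⋀^Fin k]→L[ℝ] ℂ)) hxy
    simp only [hW] at h'
    exact Subtype.ext (Subtype.ext (lefschetzPow_injective hnd h (by omega) h'))
  have hsurj : Surjective W := fun u ↦ by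
    obtain ⟨v, hv, huv⟩ := (hN' u).1 u.2
    exact ⟨⟨v, hv⟩, Subtype.ext (Subtype.ext huv.symm)⟩
  refine ⟨b.map (LinearEquiv.ofBijective W ⟨hinj, hsurj⟩), fun t ↦ ?_⟩
  rw [Basis.map_apply]
  exact hW (b t)

/-- **`G_{b'}(B_k∣N') = C · G_b(B_m∣N)` for `b' = Lˢ b`**: for sublattices `N ⊆ Hᵐ(X, ℤ)`, `N' ⊆ Hᵏ(X, ℤ)` with bases related by `b' t = Lˢ (b t)`
(`2s + m = k`, `k + q = g`, `q₂ = q + 2s`), the Gram matrix of the Lefschetz form `B_k = ⟨·, γ_q ∧ ·⟩` on `N'` is `C` times that of `B_m = ⟨·, γ_{q₂} ∧ ·⟩` on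
`N`, where `N_q · C = N_{q₂}` (§1: `C = (q+2s)!/q! · d_{q+1}⋯d_{q+2s}`). [cite: VoisinHodgeI2002, §6.3.2 Lemma 6.31 (PDF p. 128)]
[cite: Lange2023AbelianVarietiesComplex, §5.4.1 (5.22) (PDF p. 275); §1.5.1 (PDF p. 51)] [cite: Huybrechts2016K3, Ch. 14 §0.1] -/
theorem IsPolarizationType.toMatrix_restrict_eq_smul_of_coe_eq_lefschetzPow (hd : IsPolarizationType Φ η d) (hη : IsRiemannForm Φ η)
    (h : 2 * s + m = k) (hkq : k + q = j + 2) (hq₂ : q + 2 * s = q₂) (hq : q ≤ j + 2) {γ : E [⋀^Fin (2 * q)]→L[ℝ] ℂ}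
    (hγ : wedgePow (ofRealForm η) q = ((q.factorial * ∏ i : Fin q, d (Fin.castLE hq i) : ℕ) : ℂ) • γ)
    (hq₂' : q₂ ≤ j + 2) {γ₂ : E [⋀^Fin (2 * q₂)]→L[ℝ] ℂ}
    (hγ₂ : wedgePow (ofRealForm η) q₂ = ((q₂.factorial * ∏ i : Fin q₂, d (Fin.castLE hq₂' i) : ℕ) : ℂ) • γ₂)
    (e : Fin n ≃ ι) (hn : k + (2 * q + k) = n) (hn₂ : m + (2 * q₂ + m) = n)
    {B : BilinForm ℤ ↥(integralForms Φ k)}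
    (hB : ∀ x y : ↥(integralForms Φ k),
      ((B x y : ℤ) : ℂ) = poincarePairing Φ e hn (x : E [⋀^Fin k]→L[ℝ] ℂ) (γ.wedge (y : E [⋀^Fin k]→L[ℝ] ℂ)))
    {B' : BilinForm ℤ ↥(integralForms Φ m)}
    (hB' : ∀ x y : ↥(integralForms Φ m),
      ((B' x y : ℤ) : ℂ) = poincarePairing Φ e hn₂ (x : E [⋀^Fin m]→L[ℝ] ℂ) (γ₂.wedge (y : E [⋀^Fin m]→L[ℝ] ℂ)))
    {C : ℕ} (hC : (q.factorial * ∏ i : Fin q, d (Fin.castLE hq i)) * C = q₂.factorial * ∏ i : Fin q₂, d (Fin.castLE hq₂' i))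
    {N : Submodule ℤ ↥(integralForms Φ m)} {N' : Submodule ℤ ↥(integralForms Φ k)} {κ : Type*} [Fintype κ] [DecidableEq κ]
    (b : Basis κ ℤ ↥N) (b' : Basis κ ℤ ↥N')
    (hb : ∀ t, (((b' t : ↥N') : ↥(integralForms Φ k)) : E [⋀^Fin k]→L[ℝ] ℂ) =
      lefschetzPow η s h (((b t : ↥N) : ↥(integralForms Φ m)) : E [⋀^Fin m]→L[ℝ] ℂ)) :
    LinearMap.BilinForm.toMatrix b' (B.restrict N') = (C : ℤ) • LinearMap.BilinForm.toMatrix b (B'.restrict N) := by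
  have hN0 : ((q.factorial * ∏ i : Fin q, d (Fin.castLE hq i) : ℕ) : ℂ) ≠ 0 := by
    exact_mod_cast (Nat.mul_pos (Nat.factorial_pos q) (Finset.prod_pos fun i _ ↦ hd.pos hη _)).ne'
  ext t l
  rw [LinearMap.BilinForm.toMatrix_apply, Matrix.smul_apply, LinearMap.BilinForm.toMatrix_apply, smul_eq_mul]
  change B ((b' t : ↥N') : ↥(integralForms Φ k)) ((b' l : ↥N') : ↥(integralForms Φ k)) =
    (C : ℤ) * B' ((b t : ↥N) : ↥(integralForms Φ m)) ((b l : ↥N) : ↥(integralForms Φ m))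
  apply Int.cast_injective (α := ℂ)
  apply mul_left_cancel₀ hN0
  rw [hB, hb, hb, hd.content_mul_poincarePairing_lefschetzPow_eq hη e hq₂' hγ₂ hn₂ _ _ s h hkq hq₂ hq hγ hn, Int.cast_mul, Int.cast_natCast,
    hB', ← mul_assoc, ← Nat.cast_mul, hC]

/-- **`disc_{B_k}(Lˢ N) = C^{rk N} · disc_{B_m}(N)`**, `N_q · C = N_{q+2s}`: the Gram determinants of `B_k∣Lˢ N` (basis `Lˢ b`) and `B_m∣N` (basis `b`) differ
by `C^{rk N}`. [cite: VoisinHodgeI2002, §6.3.2 Lemma 6.31 (PDF p. 128)] [cite: Lange2023AbelianVarietiesComplex, §5.4.1 (5.22) (PDF p. 275); §1.5.1 (PDF p. 51)]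
[cite: Huybrechts2016K3, Ch. 14 §0.1] [cite: Kitaoka1993, Ch. 5 §5.3 Prop. 5.3.3 (proof)] -/
theorem IsPolarizationType.det_restrict_eq_pow_mul_det_of_coe_eq_lefschetzPow (hd : IsPolarizationType Φ η d) (hη : IsRiemannForm Φ η)
    (h : 2 * s + m = k) (hkq : k + q = j + 2) (hq₂ : q + 2 * s = q₂) (hq : q ≤ j + 2) {γ : E [⋀^Fin (2 * q)]→L[ℝ] ℂ}
    (hγ : wedgePow (ofRealForm η) q = ((q.factorial * ∏ i : Fin q, d (Fin.castLE hq i) : ℕ) : ℂ) • γ)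
    (hq₂' : q₂ ≤ j + 2) {γ₂ : E [⋀^Fin (2 * q₂)]→L[ℝ] ℂ}
    (hγ₂ : wedgePow (ofRealForm η) q₂ = ((q₂.factorial * ∏ i : Fin q₂, d (Fin.castLE hq₂' i) : ℕ) : ℂ) • γ₂)
    (e : Fin n ≃ ι) (hn : k + (2 * q + k) = n) (hn₂ : m + (2 * q₂ + m) = n)
    {B : BilinForm ℤ ↥(integralForms Φ k)}
    (hB : ∀ x y : ↥(integralForms Φ k),
      ((B x y : ℤ) : ℂ) = poincarePairing Φ e hn (x : E [⋀^Fin k]→L[ℝ] ℂ) (γ.wedge (y : E [⋀^Fin k]→L[ℝ] ℂ)))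
    {B' : BilinForm ℤ ↥(integralForms Φ m)}
    (hB' : ∀ x y : ↥(integralForms Φ m),
      ((B' x y : ℤ) : ℂ) = poincarePairing Φ e hn₂ (x : E [⋀^Fin m]→L[ℝ] ℂ) (γ₂.wedge (y : E [⋀^Fin m]→L[ℝ] ℂ)))
    {C : ℕ} (hC : (q.factorial * ∏ i : Fin q, d (Fin.castLE hq i)) * C = q₂.factorial * ∏ i : Fin q₂, d (Fin.castLE hq₂' i))
    {N : Submodule ℤ ↥(integralForms Φ m)} {N' : Submodule ℤ ↥(integralForms Φ k)} {κ : Type*} [Fintype κ] [DecidableEq κ]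
    (b : Basis κ ℤ ↥N) (b' : Basis κ ℤ ↥N')
    (hb : ∀ t, (((b' t : ↥N') : ↥(integralForms Φ k)) : E [⋀^Fin k]→L[ℝ] ℂ) =
      lefschetzPow η s h (((b t : ↥N) : ↥(integralForms Φ m)) : E [⋀^Fin m]→L[ℝ] ℂ)) :
    (LinearMap.BilinForm.toMatrix b' (B.restrict N')).det = (C : ℤ) ^ Fintype.card κ * (LinearMap.BilinForm.toMatrix b (B'.restrict N)).det := by
  rw [hd.toMatrix_restrict_eq_smul_of_coe_eq_lefschetzPow hη h hkq hq₂ hq hγ hq₂' hγ₂ e hn hn₂ hB hB' hC b b' hb, Matrix.det_smul]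

end Lattices

/-! ## §3 The Lefschetz pieces of `Hdgᵖ(X, ℤ)` in closed form: `disc_{B_k}(Lˢ Hdgⁱ(X, ℤ)_prim) = C^{ρ_pr^{(i)}} · disc_{B_m}(Hdgⁱ(X, ℤ)_prim)` -/

section Pieces

variable {ι : Type*} [Fintype ι] [DecidableEq ι] {E : Type*} [NormedAddCommGroup E] [NormedSpace ℂ E]
  {Φ : (ι → ℝ) ≃L[ℝ] E} {j n m k q q₂ s i : ℕ} {η : E [⋀^Fin 2]→L[ℝ] ℝ} {d : Fin (j + 2) → ℕ}

omit [Fintype ι] [DecidableEq ι] in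
/-- **The `s`-th Lefschetz piece IS `Lˢ` of the primitive Hodge lattice**: for `N ⊆ Hᵏ(X, ℤ)` with the membership predicate of g47-#3 at level `s`
(`u ∈ N ⟺ u = Lˢ y`, `y ∈ Hdg^{i'}(X, ℤ)` primitive, `2s + m' = k`) and `N₀ ⊆ Hᵐ(X, ℤ)` the primitive Hodge lattice `Hdgⁱ(X, ℤ) ∩ Pᵐ` (`i + i = m`,
`2s + m = k`): `u ∈ N ⟺ u = Lˢ v` for some `v ∈ N₀`. [cite: Lange2023AbelianVarietiesComplex, §7.3.2 (3); §5.4.1 (5.22) (PDF p. 275)] [cite: VoisinHodgeI2002, §6.2.3 Rem. 6.27 (PDF p. 126); §7.1.2 (PDF p. 134)] -/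
theorem mem_lefschetzPiece_iff_exists_mem_primitiveHodgeLattice (η : E [⋀^Fin 2]→L[ℝ] ℝ) (hm : i + i = m) (h : 2 * s + m = k)
    {N : Submodule ℤ ↥(integralForms Φ k)}
    (hN : ∀ u : ↥(integralForms Φ k), u ∈ N ↔
      ∃ (m' i' : ℕ) (_ : i' + i' = m') (h' : 2 * s + m' = k) (y : E [⋀^Fin m']→L[ℝ] ℂ),
        y ∈ integralHodgeClassesIn Φ m' i' ∧ y ∈ primitiveForms η m' ∧ (u : E [⋀^Fin k]→L[ℝ] ℂ) = lefschetzPow η s h' y)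
    {N₀ : Submodule ℤ ↥(integralForms Φ m)}
    (hN₀ : ∀ v : ↥(integralForms Φ m), v ∈ N₀ ↔
      (v : E [⋀^Fin m]→L[ℝ] ℂ) ∈ integralHodgeClassesIn Φ m i ∧ (v : E [⋀^Fin m]→L[ℝ] ℂ) ∈ primitiveForms η m)
    (u : ↥(integralForms Φ k)) :
    u ∈ N ↔ ∃ v ∈ N₀, (u : E [⋀^Fin k]→L[ℝ] ℂ) = lefschetzPow η s h (v : E [⋀^Fin m]→L[ℝ] ℂ) := by
  constructor
  · intro hu
    obtain ⟨m', i', hm', h', y, hyH, hyP, huy⟩ := (hN u).1 hu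
    obtain rfl : m = m' := by omega
    obtain rfl : i = i' := by omega
    exact ⟨⟨y, ((mem_integralHodgeClassesIn_iff Φ).1 hyH).1⟩, (hN₀ _).2 ⟨hyH, hyP⟩, huy⟩
  · rintro ⟨v, hv, huv⟩
    exact (hN u).2 ⟨m, i, hm, h, (v : E [⋀^Fin m]→L[ℝ] ℂ), ((hN₀ v).1 hv).1, ((hN₀ v).1 hv).2, huv⟩

/-- **THE DISCRIMINANT OF A LEFSCHETZ PIECE IN CLOSED FORM: `disc_{B_k}(Lˢ Hdgⁱ(X, ℤ)_prim) = C^{ρ_pr^{(i)}} · disc_{B_m}(Hdgⁱ(X, ℤ)_prim)`**, `N_q · C = N_{q+2s}`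
(`C = (q+2s)!/q! · d_{q+1}⋯d_{q+2s}`; `2s + m = k`, `i + i = m`, `k + q = g`, `B_k = ⟨·, γ_q ∧ ·⟩_e`, `B_m = ⟨·, γ_{q+2s} ∧ ·⟩_e`): every `ℤ`-basis `b₀` of the
primitive Hodge lattice `N₀ = Hdgⁱ(X, ℤ) ∩ Pᵐ ⊆ Hᵐ(X, ℤ)` is carried by `Lˢ` to a basis `b` of the piece `N = Lˢ N₀ ⊆ Hᵏ(X, ℤ)` (hard Lefschetz, `m + s ≤ g`), in
which `G_b(B_k∣N) = C · G_{b₀}(B_m∣N₀)` and `det G_b = C^{rk} · det G_{b₀}` — the discriminants of the pieces `N_s = Lˢ Hdg^{p−s}(X, ℤ)_prim` of `Hdgᵖ(X, ℤ)`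
(g47-#3/#5) are those of the primitive Hodge lattices times explicit powers of the type.
[cite: VoisinHodgeI2002, §6.3.2 Lemma 6.31, Thm. 6.32 (PDF p. 128); §6.2.3 Rem. 6.27 (PDF p. 126)] [cite: Lange2023AbelianVarietiesComplex, §5.4.1 Thm. 5.4.2 and (5.22)–(5.23) (PDF p. 275); §7.3.2 (1), (3); §1.5.1 (PDF p. 51)]
[cite: Huybrechts2016K3, Ch. 14 §0.1, §0.2] [cite: Kitaoka1993, Ch. 5 §5.3 Prop. 5.3.3 (proof)] -/
theorem IsPolarizationType.exists_basis_det_restrict_lefschetzPiece_eq_pow_mul_det_primitiveHodgeLattice (hd : IsPolarizationType Φ η d)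
    (hη : IsRiemannForm Φ η) (hm : i + i = m) (h : 2 * s + m = k) (hkq : k + q = j + 2) (hq₂ : q + 2 * s = q₂) (hq : q ≤ j + 2)
    {γ : E [⋀^Fin (2 * q)]→L[ℝ] ℂ} (hγ : wedgePow (ofRealForm η) q = ((q.factorial * ∏ i : Fin q, d (Fin.castLE hq i) : ℕ) : ℂ) • γ)
    (hq₂' : q₂ ≤ j + 2) {γ₂ : E [⋀^Fin (2 * q₂)]→L[ℝ] ℂ}
    (hγ₂ : wedgePow (ofRealForm η) q₂ = ((q₂.factorial * ∏ i : Fin q₂, d (Fin.castLE hq₂' i) : ℕ) : ℂ) • γ₂)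
    (e : Fin n ≃ ι) (hn : k + (2 * q + k) = n) (hn₂ : m + (2 * q₂ + m) = n)
    {B : BilinForm ℤ ↥(integralForms Φ k)}
    (hB : ∀ x y : ↥(integralForms Φ k),
      ((B x y : ℤ) : ℂ) = poincarePairing Φ e hn (x : E [⋀^Fin k]→L[ℝ] ℂ) (γ.wedge (y : E [⋀^Fin k]→L[ℝ] ℂ)))
    {B' : BilinForm ℤ ↥(integralForms Φ m)}
    (hB' : ∀ x y : ↥(integralForms Φ m),
      ((B' x y : ℤ) : ℂ) = poincarePairing Φ e hn₂ (x : E [⋀^Fin m]→L[ℝ] ℂ) (γ₂.wedge (y : E [⋀^Fin m]→L[ℝ] ℂ)))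
    {C : ℕ} (hC : (q.factorial * ∏ i : Fin q, d (Fin.castLE hq i)) * C = q₂.factorial * ∏ i : Fin q₂, d (Fin.castLE hq₂' i))
    {N : Submodule ℤ ↥(integralForms Φ k)}
    (hN : ∀ u : ↥(integralForms Φ k), u ∈ N ↔
      ∃ (m' i' : ℕ) (_ : i' + i' = m') (h' : 2 * s + m' = k) (y : E [⋀^Fin m']→L[ℝ] ℂ),
        y ∈ integralHodgeClassesIn Φ m' i' ∧ y ∈ primitiveForms η m' ∧ (u : E [⋀^Fin k]→L[ℝ] ℂ) = lefschetzPow η s h' y)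
    {N₀ : Submodule ℤ ↥(integralForms Φ m)}
    (hN₀ : ∀ v : ↥(integralForms Φ m), v ∈ N₀ ↔
      (v : E [⋀^Fin m]→L[ℝ] ℂ) ∈ integralHodgeClassesIn Φ m i ∧ (v : E [⋀^Fin m]→L[ℝ] ℂ) ∈ primitiveForms η m)
    {κ : Type*} [Fintype κ] [DecidableEq κ] (b₀ : Basis κ ℤ ↥N₀) :
    ∃ b : Basis κ ℤ ↥N,
      (∀ t, (((b t : ↥N) : ↥(integralForms Φ k)) : E [⋀^Fin k]→L[ℝ] ℂ) =
        lefschetzPow η s h (((b₀ t : ↥N₀) : ↥(integralForms Φ m)) : E [⋀^Fin m]→L[ℝ] ℂ)) ∧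
      LinearMap.BilinForm.toMatrix b (B.restrict N) = (C : ℤ) • LinearMap.BilinForm.toMatrix b₀ (B'.restrict N₀) ∧
      (LinearMap.BilinForm.toMatrix b (B.restrict N)).det = (C : ℤ) ^ Fintype.card κ * (LinearMap.BilinForm.toMatrix b₀ (B'.restrict N₀)).det := by
  have hN' := mem_lefschetzPiece_iff_exists_mem_primitiveHodgeLattice (Φ := Φ) η hm h hN hN₀
  obtain ⟨b, hb⟩ := hd.exists_basis_coe_eq_lefschetzPow hη h (by omega) hN' b₀
  exact ⟨b, hb, hd.toMatrix_restrict_eq_smul_of_coe_eq_lefschetzPow hη h hkq hq₂ hq hγ hq₂' hγ₂ e hn hn₂ hB hB' hC b₀ b hb,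
    hd.det_restrict_eq_pow_mul_det_of_coe_eq_lefschetzPow hη h hkq hq₂ hq hγ hq₂' hγ₂ e hn hn₂ hB hB' hC b₀ b hb⟩

/-- **`rk (Lˢ Hdgⁱ(X, ℤ)_prim) = rk Hdgⁱ(X, ℤ)_prim` and `|disc_{B_k}(Lˢ Hdgⁱ(X, ℤ)_prim)| = C^{ρ_pr^{(i)}} · |disc_{B_m}(Hdgⁱ(X, ℤ)_prim)|` with `C ≥ 1`**:
the piece has the same rank as the primitive Hodge lattice and a discriminant LARGER in absolute value by the explicit factor `C^{ρ_pr^{(i)}}`,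
`C = (q+2s)!/q! · d_{q+1}⋯d_{q+2s}` — data-free form (the bases and the ratio are produced inside).
[cite: VoisinHodgeI2002, §6.3.2 Lemma 6.31 (PDF p. 128)] [cite: Lange2023AbelianVarietiesComplex, §5.4.1 (5.22)–(5.23) (PDF p. 275); §7.3.2 (1), (3)] [cite: Huybrechts2016K3, Ch. 14 §0.1] -/
theorem IsPolarizationType.exists_natAbs_det_restrict_lefschetzPiece_eq (hd : IsPolarizationType Φ η d)
    (hη : IsRiemannForm Φ η) (hm : i + i = m) (h : 2 * s + m = k) (hkq : k + q = j + 2) (hq₂ : q + 2 * s = q₂) (hq : q ≤ j + 2)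
    {γ : E [⋀^Fin (2 * q)]→L[ℝ] ℂ} (hγ : wedgePow (ofRealForm η) q = ((q.factorial * ∏ i : Fin q, d (Fin.castLE hq i) : ℕ) : ℂ) • γ)
    (hq₂' : q₂ ≤ j + 2) {γ₂ : E [⋀^Fin (2 * q₂)]→L[ℝ] ℂ}
    (hγ₂ : wedgePow (ofRealForm η) q₂ = ((q₂.factorial * ∏ i : Fin q₂, d (Fin.castLE hq₂' i) : ℕ) : ℂ) • γ₂)
    (e : Fin n ≃ ι) (hn : k + (2 * q + k) = n) (hn₂ : m + (2 * q₂ + m) = n)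
    {B : BilinForm ℤ ↥(integralForms Φ k)}
    (hB : ∀ x y : ↥(integralForms Φ k),
      ((B x y : ℤ) : ℂ) = poincarePairing Φ e hn (x : E [⋀^Fin k]→L[ℝ] ℂ) (γ.wedge (y : E [⋀^Fin k]→L[ℝ] ℂ)))
    {B' : BilinForm ℤ ↥(integralForms Φ m)}
    (hB' : ∀ x y : ↥(integralForms Φ m),
      ((B' x y : ℤ) : ℂ) = poincarePairing Φ e hn₂ (x : E [⋀^Fin m]→L[ℝ] ℂ) (γ₂.wedge (y : E [⋀^Fin m]→L[ℝ] ℂ)))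
    {N : Submodule ℤ ↥(integralForms Φ k)}
    (hN : ∀ u : ↥(integralForms Φ k), u ∈ N ↔
      ∃ (m' i' : ℕ) (_ : i' + i' = m') (h' : 2 * s + m' = k) (y : E [⋀^Fin m']→L[ℝ] ℂ),
        y ∈ integralHodgeClassesIn Φ m' i' ∧ y ∈ primitiveForms η m' ∧ (u : E [⋀^Fin k]→L[ℝ] ℂ) = lefschetzPow η s h' y)
    {N₀ : Submodule ℤ ↥(integralForms Φ m)}
    (hN₀ : ∀ v : ↥(integralForms Φ m), v ∈ N₀ ↔
      (v : E [⋀^Fin m]→L[ℝ] ℂ) ∈ integralHodgeClassesIn Φ m i ∧ (v : E [⋀^Fin m]→L[ℝ] ℂ) ∈ primitiveForms η m)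
    {κ : Type*} [Fintype κ] [DecidableEq κ] (b₀ : Basis κ ℤ ↥N₀) :
    ∃ (C : ℕ) (b : Basis κ ℤ ↥N), 0 < C ∧
      (q.factorial * ∏ i : Fin q, d (Fin.castLE hq i)) * C = q₂.factorial * ∏ i : Fin q₂, d (Fin.castLE hq₂' i) ∧
      (LinearMap.BilinForm.toMatrix b (B.restrict N)).det.natAbs = C ^ Fintype.card κ * (LinearMap.BilinForm.toMatrix b₀ (B'.restrict N₀)).det.natAbs := by
  obtain ⟨C, hC0, hC⟩ := hd.exists_pos_content_mul_eq_content hη s hq₂ hq hq₂'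
  obtain ⟨b, -, -, hdet⟩ := hd.exists_basis_det_restrict_lefschetzPiece_eq_pow_mul_det_primitiveHodgeLattice hη hm h hkq hq₂ hq hγ hq₂' hγ₂
    e hn hn₂ hB hB' hC hN hN₀ b₀
  refine ⟨C, b, hC0, hC, ?_⟩
  rw [hdet, Int.natAbs_mul, Int.natAbs_pow, Int.natAbs_natCast]

end Pieces

end Literature.Geometry.Kaehler.ComplexTorus

end
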